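import Summits.HodgeConjecture.HodgeConjecture.Theorems.Ring2WeilCoverageCMFieldRationalClassesPrimeSupport
import HarnessLib

/-!
# Ring 2 — Weil-family coverage, CM-field rows: the union statement AWAY FROM THE RAMIFIED PLACE OF `F` — the cyclic
  quartic tables (WEIL-FAMILY-COVERAGE «## b03», cell (xxi⁸), part 46)

research route conditional on HC_CM; not a corollary; Q11.4-sentence-2 already refuted in dim ≥ 3.

Part 41 proved, for the fifteen BIQUADRATIC census fields, that the label `T(c) = {𝔭 : (c, θ)_𝔭 = -1}` of a positive
rational class is the union of the full fibres of `Spec 𝓞_F → Spec ℤ` over the non-norm primes of odd exponent in `c`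
[cite: Deligne1982HodgeCycles, §4 (1), Prop. 4.1, Cor. 4.2].  For the five CYCLIC quartic CM fields (`F = ℚ(√d)`,
`d = 5` resp. `2`; `q = θθ' = s₀²` in `𝓞_F`) the one place of `F` RAMIFIED over `ℚ` — `(√5)` resp. the dyadic `(√2)` —
does enter rational classes (`T(2) = {(2), (√5)}`, `T(3) = {(√2), (3)}`, b03.32 (ii)).  This file proves that it is
the ONLY exception, uniformly in the carrier:

* §132 (any carrier) PARITY OF THE PRIME SUPPORT: if `x ∈ T(ℓ) ⟺ P ℓ` for every prime `ℓ` (`P` decidable), then for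
  `n ≥ 1` **`x ∈ T(n) ⟺` the number of prime factors of `n` in `P`, counted with multiplicity, is odd**
  (`Odd (n.factorization.sum (fun ℓ e ↦ if P ℓ then e else 0))`), and the same for `c ∈ ℚ_{>0}` with `num·den`.
* §133 (quadratic carriers `R = S² + pS + q`, `q = s₀²` in `𝓞_F`, a prime `p₀ ∣ 2q` whose place `v₀` is «the ramified
  place», places over the primes dividing `2q` unique) **THE FIBRE STRUCTURE AWAY FROM `v₀`**: if every place
  `v ≠ v₀` satisfies «`v ∈ T(ℓ) ⟹ ℓ ∈ v`» (per carrier: 63:12), then for every prime `ℓ` and every `v ≠ v₀`: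
  **`v ∈ T(ℓ) ⟺ ℓ ∈ v ∧ T(ℓ) ≠ ∅`** (a witness of `T(ℓ) ≠ ∅` other than `v₀` exists by Hilbert reciprocity — `|T(ℓ)|`
  is even —, contains `ℓ`, and saturation (B) of part 33 carries membership across the fibre).
* §134 **THE UNION STATEMENT AWAY FROM `v₀`** for `c ∈ ℚ_{>0}` and `v ≠ v₀` over `ℓ`: **`v ∈ T(c) ⟺ ord_ℓ(c)` odd
  `∧ T(ℓ) ≠ ∅`**; and — since `v₀ ∈ T(c)` is then FIXED BY PARITY — the class theorems hold VERBATIM as in the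
  biquadratic case: **`[c] = [c′] ⟺ (Odd ord_ℓ c ↔ Odd ord_ℓ c′)` at every non-norm prime `ℓ`**, **`[c] = [(-1)^k] ⟺
  ord_ℓ c` even at every non-norm prime** (`T(p₀) = ∅` assumed: `p₀` is a norm for all five carriers).
* §135 tools for the instances: at an odd INERT prime (`p² - 4q`, `q` non-squares mod `ℓ`) the place `(ℓ)` lies in
  `T(ℓ)` and is the only place over `ℓ`; the membership form of part 27 (c) (`(πw, πt)_v = -1`).

Instances (the three carriers over `ℚ(√5)` and the two over `ℚ(√2)`) in the sequel.  No new definition, no named fact,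
no sorry; nothing about the Hodge conjecture is asserted.
-/

noncomputable section

set_option linter.dupNamespace false

open Polynomial NumberField IsDedekindDomain

namespace Summit.HodgeConjecture.HodgeConjecture.Ring2.WeilCoverageCM

open Literature.AlgebraicGeometry.Deligne1982
open Literature.AlgebraicGeometry.HodgeTheory (splitDiscriminantClassCM)
open Literature.NumberTheory.QuadraticForms

variable {R : Polynomial ℤ} [Fact (Irreducible (cmPolyQ R))] [Fact (Irreducible (realPolyQ R))]

/-! ### §132 Parity of the prime support — every carrier -/

/-- **PARITY OF THE PRIME SUPPORT, integers**: if the place `x` lies in `T(ℓ)` exactly for the primes `ℓ` with `P ℓ`,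
then for `n ≥ 1`, **`x ∈ T(n)` iff the number of prime factors of `n` satisfying `P`, counted with multiplicity, is
odd** (`T(ab) = T(a) ∆ T(b)`, `(ab).factorization = a.factorization + b.factorization`).
[cite: Deligne1982HodgeCycles, §4 (1)] [cite: Omeara1963, §63B (multiplicativity of the symbol)] -/
theorem mem_badPlaces_natCast_iff_odd_sum_factorization
    (x : HeightOneSpectrum (𝓞 (realField R)) ⊕ InfinitePlace (realField R)) (P : ℕ → Prop) [DecidablePred P]
    (hP : ∀ ℓ : ℕ, ℓ.Prime → (x ∈ badPlaces (ℓ : realField R) (AdjoinRoot.root (realPolyQ R)) ↔ P ℓ))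
    {n : ℕ} (hn : n ≠ 0) :
    x ∈ badPlaces (n : realField R) (AdjoinRoot.root (realPolyQ R)) ↔
      Odd (n.factorization.sum fun ℓ e ↦ if P ℓ then e else 0) := by
  have h0 : ∀ ℓ : ℕ, (if P ℓ then (0 : ℕ) else 0) = 0 := fun ℓ ↦ ite_self 0
  induction n using Nat.recOnMul with
  | zero => exact absurd rfl hn
  | one =>
    rw [Nat.cast_one, badPlaces_one, Nat.factorization_one, Finsupp.sum_zero_index]
    exact ⟨fun h ↦ absurd h (Set.notMem_empty _), fun h ↦ absurd h (Nat.not_odd_iff_even.2 ⟨0, rfl⟩)⟩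
  | prime p hp =>
    rw [hP p hp, Nat.Prime.factorization hp, Finsupp.sum_single_index (h := fun ℓ e ↦ if P ℓ then e else 0) (h0 p)]
    by_cases hPp : P p
    · rw [if_pos hPp]; exact ⟨fun _ ↦ odd_one, fun _ ↦ hPp⟩
    · rw [if_neg hPp]; exact ⟨fun h ↦ absurd h hPp, fun h ↦ absurd h (Nat.not_odd_iff_even.2 ⟨0, rfl⟩)⟩
  | mul a b iha ihb =>
    have ha : a ≠ 0 := fun h ↦ hn (by rw [h, zero_mul])
    have hb : b ≠ 0 := fun h ↦ hn (by rw [h, mul_zero])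
    have iha' : x ∈ badPlaces ((a : ℕ) : realField R) (AdjoinRoot.root (realPolyQ R)) ↔
        Odd (a.factorization.sum fun ℓ e ↦ if P ℓ then e else 0) := iha ha
    have ihb' : x ∈ badPlaces ((b : ℕ) : realField R) (AdjoinRoot.root (realPolyQ R)) ↔
        Odd (b.factorization.sum fun ℓ e ↦ if P ℓ then e else 0) := ihb hb
    have hadd : ((a * b).factorization.sum fun ℓ e ↦ if P ℓ then e else 0) =
        (a.factorization.sum fun ℓ e ↦ if P ℓ then e else 0) + (b.factorization.sum fun ℓ e ↦ if P ℓ then e else 0) := by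
      rw [Nat.factorization_mul ha hb, Finsupp.sum_add_index' (h := fun ℓ e ↦ if P ℓ then e else 0) h0]
      intro ℓ e₁ e₂
      by_cases hPl : P ℓ
      · simp only [if_pos hPl]
      · simp only [if_neg hPl, add_zero]
    rw [Nat.cast_mul, badPlaces_mul (by exact_mod_cast ha) (by exact_mod_cast hb) root_realPolyQ_ne_zero,
      Set.mem_symmDiff, iha', ihb', hadd, Nat.odd_add', ← Nat.not_odd_iff_even]
    clear iha ihb iha' ihb' hP hadd
    generalize (Odd (a.factorization.sum fun ℓ e ↦ if P ℓ then e else 0)) = A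
    generalize (Odd (b.factorization.sum fun ℓ e ↦ if P ℓ then e else 0)) = B
    tauto

/-- **PARITY OF THE PRIME SUPPORT, positive rationals**: with `x ∈ T(ℓ) ⟺ P ℓ` for every prime `ℓ`, for `c ∈ ℚ_{>0}`
**`x ∈ T(c)` iff the number of prime factors of `num(c)·den(c)` satisfying `P`, counted with multiplicity, is odd**
(`T(c) = T(num) ∆ T(den)`). [cite: Deligne1982HodgeCycles, §4 (1)] [cite: Omeara1963, §63B] -/
theorem mem_badPlaces_ratCast_iff_odd_sum_factorization
    (x : HeightOneSpectrum (𝓞 (realField R)) ⊕ InfinitePlace (realField R)) (P : ℕ → Prop) [DecidablePred P]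
    (hP : ∀ ℓ : ℕ, ℓ.Prime → (x ∈ badPlaces (ℓ : realField R) (AdjoinRoot.root (realPolyQ R)) ↔ P ℓ))
    {c : ℚ} (hc : 0 < c) :
    x ∈ badPlaces (c : realField R) (AdjoinRoot.root (realPolyQ R)) ↔
      Odd ((c.num.natAbs * c.den).factorization.sum fun ℓ e ↦ if P ℓ then e else 0) := by
  have h0 : ∀ ℓ : ℕ, (if P ℓ then (0 : ℕ) else 0) = 0 := fun ℓ ↦ ite_self 0
  have hnum : 0 < c.num := Rat.num_pos.2 hc
  obtain ⟨m, hm⟩ : ∃ m : ℕ, (m : ℤ) = c.num := ⟨c.num.toNat, Int.toNat_of_nonneg hnum.le⟩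
  have hm0 : m ≠ 0 := by rintro rfl; rw [Nat.cast_zero] at hm; exact hnum.ne' hm.symm
  have hden : c.den ≠ 0 := c.den_nz
  have hdenF : ((c.den : ℕ) : realField R) ≠ 0 := by exact_mod_cast hden
  have hmF : ((m : ℕ) : realField R) ≠ 0 := by exact_mod_cast hm0
  have ec : (c : realField R) = (m : realField R) * ((c.den : realField R))⁻¹ := by
    rw [← div_eq_mul_inv, Rat.cast_def, ← hm, Int.cast_natCast]
  have hinv : badPlaces (((c.den : ℕ) : realField R))⁻¹ (AdjoinRoot.root (realPolyQ R)) =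
      badPlaces ((c.den : ℕ) : realField R) (AdjoinRoot.root (realPolyQ R)) := by
    have h := badPlaces_inv (R := R) (Units.mk0 ((c.den : ℕ) : realField R) hdenF)
    rwa [Units.val_inv_eq_inv_val, Units.val_mk0] at h
  have hnat : c.num.natAbs = m := by rw [← hm, Int.natAbs_natCast]
  have hadd : ((m * c.den).factorization.sum fun ℓ e ↦ if P ℓ then e else 0) =
      (m.factorization.sum fun ℓ e ↦ if P ℓ then e else 0) + (c.den.factorization.sum fun ℓ e ↦ if P ℓ then e else 0) := by
    rw [Nat.factorization_mul hm0 hden, Finsupp.sum_add_index' (h := fun ℓ e ↦ if P ℓ then e else 0) h0]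
    intro ℓ e₁ e₂
    by_cases hPl : P ℓ
    · simp only [if_pos hPl]
    · simp only [if_neg hPl, add_zero]
  rw [ec, badPlaces_mul hmF (inv_ne_zero hdenF) root_realPolyQ_ne_zero, hinv, Set.mem_symmDiff,
    mem_badPlaces_natCast_iff_odd_sum_factorization x P hP hm0, mem_badPlaces_natCast_iff_odd_sum_factorization x P hP hden,
    hnat, hadd, Nat.odd_add', ← Nat.not_odd_iff_even]
  clear hP hinv ec hadd
  generalize (Odd (m.factorization.sum fun ℓ e ↦ if P ℓ then e else 0)) = A
  generalize (Odd (c.den.factorization.sum fun ℓ e ↦ if P ℓ then e else 0)) = B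
  tauto

/-! ### §133 The fibre structure away from the ramified place `v₀ ∋ p₀` (quadratic carriers with `q = s₀²` in `𝓞_F`) -/

/-- **`T(ℓ) ∖ {v₀}` IS EMPTY OR THE FULL FIBRE OVER `ℓ` (minus `v₀`).** Let `R = S² + pS + q` (roots real negative),
`θθ' = q = s₀²` in `𝓞_F` (the cyclic carriers), `p₀ ∣ 2q` a prime whose place `v₀` we call the ramified place, and
suppose: the places over the primes dividing `2q` are unique, and every finite place `v ≠ v₀` lying in some `T(ℓ)`
contains `ℓ`. Then for every prime `ℓ` and every finite `v ≠ v₀`: **`v ∈ T(ℓ) ⟺ ℓ ∈ v ∧ T(ℓ) ≠ ∅`** (⟸: `T(ℓ)` has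
a member other than `v₀` — else `|T(ℓ)| = 1`, against Hilbert reciprocity —, it is a finite place `u ∋ ℓ`, and either
`u = v` or `ℓ ∤ 2q` and part 33 (B) moves membership from `u` to `v`). [cite: Omeara1963, §63B Example 63:12 and §71D
Thm. 71:18] [cite: Deligne1982HodgeCycles, §4 (1) and Cor. 4.2] -/
theorem inl_mem_badPlaces_natCast_iff_mem_and_nonempty_of_ramified {p q : ℤ} (hR : R = X ^ 2 + C p * X + C q)
    (hroots : ∀ s : ℂ, Polynomial.eval₂ (Int.castRingHom ℂ) s R = 0 → s.im = 0 ∧ s.re < 0)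
    {θₒ s₀ : 𝓞 (realField R)} (hθ : (θₒ : realField R) = AdjoinRoot.root (realPolyQ R)) (hs : s₀ ^ 2 = q)
    {p₀ : ℕ} (hp₀ : p₀.Prime) (hp₀q : (p₀ : ℤ) ∣ 2 * q)
    (huq : ∀ ℓ : ℕ, ℓ.Prime → (ℓ : ℤ) ∣ 2 * q → ∀ v v' : HeightOneSpectrum (𝓞 (realField R)),
      (ℓ : 𝓞 (realField R)) ∈ v.asIdeal → (ℓ : 𝓞 (realField R)) ∈ v'.asIdeal → v = v')
    (hfix : ∀ v : HeightOneSpectrum (𝓞 (realField R)), (p₀ : 𝓞 (realField R)) ∉ v.asIdeal →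
      ∀ ℓ : ℕ, ℓ.Prime → Sum.inl v ∈ badPlaces (ℓ : realField R) (AdjoinRoot.root (realPolyQ R)) →
        (ℓ : 𝓞 (realField R)) ∈ v.asIdeal)
    {ℓ : ℕ} (hℓ : ℓ.Prime) (v : HeightOneSpectrum (𝓞 (realField R))) (hv : (p₀ : 𝓞 (realField R)) ∉ v.asIdeal) :
    Sum.inl v ∈ badPlaces (ℓ : realField R) (AdjoinRoot.root (realPolyQ R)) ↔
      (ℓ : 𝓞 (realField R)) ∈ v.asIdeal ∧ (badPlaces (ℓ : realField R) (AdjoinRoot.root (realPolyQ R))).Nonempty := by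
  refine ⟨fun h ↦ ⟨hfix v hv ℓ hℓ h, ⟨_, h⟩⟩, ?_⟩
  rintro ⟨hℓv, hne⟩
  have hK := finrank_realField_quadratic hR
  have hℓ0 : (ℓ : realField R) ≠ 0 := by exact_mod_cast hℓ.ne_zero
  -- a bad place other than the ramified place
  obtain ⟨v₀, hv₀⟩ := exists_place_natCast_mem hK hp₀
  have hother : ∃ u : HeightOneSpectrum (𝓞 (realField R)), (p₀ : 𝓞 (realField R)) ∉ u.asIdeal ∧
      Sum.inl u ∈ badPlaces (ℓ : realField R) (AdjoinRoot.root (realPolyQ R)) := by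
    by_contra hno
    push Not at hno
    have hsub : badPlaces (ℓ : realField R) (AdjoinRoot.root (realPolyQ R)) = {Sum.inl v₀} := by
      apply Set.Subset.antisymm
      · rintro (u | w) hu
        · rw [Set.mem_singleton_iff]
          by_cases hpu : (p₀ : 𝓞 (realField R)) ∈ u.asIdeal
          · rw [huq p₀ hp₀ hp₀q u v₀ hpu hv₀]
          · exact absurd hu (hno u hpu)
        · exact absurd hu (inr_notMem_badPlaces_natCast hroots w hℓ)
      · obtain ⟨x, hx⟩ := hne
        rcases x with u | w
        · by_cases hpu : (p₀ : 𝓞 (realField R)) ∈ u.asIdeal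
          · rw [← huq p₀ hp₀ hp₀q u v₀ hpu hv₀]; rintro _ ⟨rfl⟩; exact hx
          · exact absurd hx (hno u hpu)
        · exact absurd hx (inr_notMem_badPlaces_natCast hroots w hℓ)
    have heven := (even_ncard_badPlaces (R := R) (Units.mk0 (ℓ : realField R) hℓ0)).2
    rw [Units.val_mk0, hsub, Set.ncard_singleton] at heven
    exact (Nat.not_even_iff_odd.2 odd_one) heven
  obtain ⟨u, hpu, hu⟩ := hother
  have hℓu := hfix u hpu ℓ hℓ hu
  by_cases huv : u = v
  · rw [← huv]; exact hu
  -- `u ≠ v` over `ℓ`: `ℓ ∤ 2q`, so `ℓ` is odd, `ℓ ∤ q`, and saturation (B) applies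
  have hℓ2q : ¬ (ℓ : ℤ) ∣ 2 * q := fun h ↦ huv (huq ℓ hℓ h u v hℓu hℓv)
  have hℓ2 : ℓ ≠ 2 := by
    rintro rfl
    exact hℓ2q (dvd_mul_right _ _)
  have hℓq : ¬ (ℓ : ℤ) ∣ q := fun h ↦ hℓ2q (Dvd.dvd.mul_left h _)
  have key := (inl_mem_badPlaces_ratCast_iff_of_sq_eq hR hθ hs hℓ hℓ2 hℓq u v hℓu hℓv
    (c := (ℓ : ℚ)) (by exact_mod_cast hℓ.ne_zero)).1
  rw [Rat.cast_natCast] at key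
  exact key hu

/-! ### §134 The union statement away from `v₀`, and the classes of the positive rationals -/

/-- **THE UNION STATEMENT AWAY FROM THE RAMIFIED PLACE.** Under the hypotheses of §133, for `c ∈ ℚ_{>0}` and a finite place
`v ≠ v₀` over the rational prime `ℓ`: **`v ∈ T(c) ⟺ ord_ℓ(c)` is odd `∧ T(ℓ) ≠ ∅`**. [cite: Deligne1982HodgeCycles, §4
(1) and Cor. 4.2] [cite: Omeara1963, §63B Example 63:12 and §71D Thm. 71:18] -/
theorem inl_mem_badPlaces_ratCast_iff_odd_padicValRat_of_ramified {p q : ℤ} (hR : R = X ^ 2 + C p * X + C q)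
    (hroots : ∀ s : ℂ, Polynomial.eval₂ (Int.castRingHom ℂ) s R = 0 → s.im = 0 ∧ s.re < 0)
    {θₒ s₀ : 𝓞 (realField R)} (hθ : (θₒ : realField R) = AdjoinRoot.root (realPolyQ R)) (hs : s₀ ^ 2 = q)
    {p₀ : ℕ} (hp₀ : p₀.Prime) (hp₀q : (p₀ : ℤ) ∣ 2 * q)
    (huq : ∀ ℓ : ℕ, ℓ.Prime → (ℓ : ℤ) ∣ 2 * q → ∀ v v' : HeightOneSpectrum (𝓞 (realField R)),
      (ℓ : 𝓞 (realField R)) ∈ v.asIdeal → (ℓ : 𝓞 (realField R)) ∈ v'.asIdeal → v = v')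
    (hfix : ∀ v : HeightOneSpectrum (𝓞 (realField R)), (p₀ : 𝓞 (realField R)) ∉ v.asIdeal →
      ∀ ℓ : ℕ, ℓ.Prime → Sum.inl v ∈ badPlaces (ℓ : realField R) (AdjoinRoot.root (realPolyQ R)) →
        (ℓ : 𝓞 (realField R)) ∈ v.asIdeal)
    {c : ℚ} (hc : 0 < c) (v : HeightOneSpectrum (𝓞 (realField R))) (hv : (p₀ : 𝓞 (realField R)) ∉ v.asIdeal)
    {ℓ : ℕ} (hℓ : ℓ.Prime) (hℓv : (ℓ : 𝓞 (realField R)) ∈ v.asIdeal) :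
    Sum.inl v ∈ badPlaces (c : realField R) (AdjoinRoot.root (realPolyQ R)) ↔
      Odd (padicValRat ℓ c) ∧ (badPlaces (ℓ : realField R) (AdjoinRoot.root (realPolyQ R))).Nonempty := by
  rw [mem_badPlaces_ratCast_iff_of_prime_support _ hℓ
      (fun ℓ' hℓ' hne h ↦ hne (prime_natCast_mem_unique hℓ' hℓ v (hfix v hv ℓ' hℓ' h) hℓv)) hc,
    inl_mem_badPlaces_natCast_iff_mem_and_nonempty_of_ramified hR hroots hθ hs hp₀ hp₀q huq hfix hℓ v hv]
  exact ⟨fun h ↦ ⟨h.1, h.2.2⟩, fun h ↦ ⟨h.1, hℓv, h.2⟩⟩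

/-- **THE CLASSES OF THE POSITIVE RATIONALS (cyclic form): `[c] = [c'] ⟺ ord_ℓ(c) ≡ ord_ℓ(c') (mod 2)` at every
NON-NORM prime `ℓ`** (`T(ℓ) ≠ ∅`), `c, c' ∈ ℚ_{>0}`, under the hypotheses of §133 and `T(p₀) = ∅` — membership of the
ramified place `v₀` is fixed by the parity of the rest (Hilbert reciprocity), so it imposes no extra condition.
[cite: Deligne1982HodgeCycles, §4 (1), Prop. 4.1 and Cor. 4.2] [cite: Omeara1963, §65D Thm. 65:23 and §71D Thm. 71:18] -/
theorem mk_ratCast_eq_mk_ratCast_iff_of_ramified {p q : ℤ} (hR : R = X ^ 2 + C p * X + C q)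
    (hroots : ∀ s : ℂ, Polynomial.eval₂ (Int.castRingHom ℂ) s R = 0 → s.im = 0 ∧ s.re < 0)
    {θₒ s₀ : 𝓞 (realField R)} (hθ : (θₒ : realField R) = AdjoinRoot.root (realPolyQ R)) (hs : s₀ ^ 2 = q)
    {p₀ : ℕ} (hp₀ : p₀.Prime) (hp₀q : (p₀ : ℤ) ∣ 2 * q)
    (huq : ∀ ℓ : ℕ, ℓ.Prime → (ℓ : ℤ) ∣ 2 * q → ∀ v v' : HeightOneSpectrum (𝓞 (realField R)),
      (ℓ : 𝓞 (realField R)) ∈ v.asIdeal → (ℓ : 𝓞 (realField R)) ∈ v'.asIdeal → v = v')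
    (hfix : ∀ v : HeightOneSpectrum (𝓞 (realField R)), (p₀ : 𝓞 (realField R)) ∉ v.asIdeal →
      ∀ ℓ : ℕ, ℓ.Prime → Sum.inl v ∈ badPlaces (ℓ : realField R) (AdjoinRoot.root (realPolyQ R)) →
        (ℓ : 𝓞 (realField R)) ∈ v.asIdeal)
    (hT₀ : badPlaces (p₀ : realField R) (AdjoinRoot.root (realPolyQ R)) = ∅)
    {c c' : ℚ} (hc : 0 < c) (hc' : 0 < c') (γ γ' : (realField R)ˣ) (hγ : (γ : realField R) = (c : realField R))
    (hγ' : (γ' : realField R) = (c' : realField R)) :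
    (QuotientGroup.mk γ : cmNormResidueGroup R) = QuotientGroup.mk γ' ↔
      ∀ ℓ : ℕ, ℓ.Prime → (badPlaces (ℓ : realField R) (AdjoinRoot.root (realPolyQ R))).Nonempty →
        (Odd (padicValRat ℓ c) ↔ Odd (padicValRat ℓ c')) := by
  have hK := finrank_realField_quadratic hR
  obtain ⟨v₀, hv₀⟩ := exists_place_natCast_mem hK hp₀
  have U := fun {d : ℚ} (hd : 0 < d) (v : HeightOneSpectrum (𝓞 (realField R))) (hv : (p₀ : 𝓞 (realField R)) ∉ v.asIdeal)
    {ℓ : ℕ} (hℓ : ℓ.Prime) (hℓv : (ℓ : 𝓞 (realField R)) ∈ v.asIdeal) ↦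
    inl_mem_badPlaces_ratCast_iff_odd_padicValRat_of_ramified hR hroots hθ hs hp₀ hp₀q huq hfix hd v hv hℓ hℓv
  rw [mk_eq_mk_iff_badPlaces_eq, hγ, hγ']
  constructor
  · intro h ℓ hℓ hne
    have hℓp : ℓ ≠ p₀ := by
      rintro rfl
      rw [hT₀] at hne
      exact Set.not_nonempty_empty hne
    obtain ⟨v, hv⟩ := exists_place_natCast_mem hK hℓ
    have hpv : (p₀ : 𝓞 (realField R)) ∉ v.asIdeal := fun hpv ↦ hℓp (prime_natCast_mem_unique hℓ hp₀ v hv hpv)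
    have e : Sum.inl v ∈ badPlaces (c : realField R) (AdjoinRoot.root (realPolyQ R)) ↔
        Sum.inl v ∈ badPlaces (c' : realField R) (AdjoinRoot.root (realPolyQ R)) := by rw [h]
    rw [U hc v hpv hℓ hv, U hc' v hpv hℓ hv] at e
    exact ⟨fun h1 ↦ (e.1 ⟨h1, hne⟩).1, fun h1 ↦ (e.2 ⟨h1, hne⟩).1⟩
  · intro h
    -- the places other than `v₀` agree
    have hoff : ∀ x : HeightOneSpectrum (𝓞 (realField R)) ⊕ InfinitePlace (realField R), x ≠ Sum.inl v₀ →
        (x ∈ badPlaces (c : realField R) (AdjoinRoot.root (realPolyQ R)) ↔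
          x ∈ badPlaces (c' : realField R) (AdjoinRoot.root (realPolyQ R))) := by
      rintro (v | w) hx
      · have hpv : (p₀ : 𝓞 (realField R)) ∉ v.asIdeal := fun hpv ↦ hx (by rw [huq p₀ hp₀ hp₀q v v₀ hpv hv₀])
        obtain ⟨ℓ, hℓ, hℓv⟩ := exists_prime_natCast_mem v
        rw [U hc v hpv hℓ hℓv, U hc' v hpv hℓ hℓv]
        exact ⟨fun h1 ↦ ⟨(h ℓ hℓ h1.2).1 h1.1, h1.2⟩, fun h1 ↦ ⟨(h ℓ hℓ h1.2).2 h1.1, h1.2⟩⟩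
      · exact iff_of_false (inr_notMem_badPlaces_ratCast_of_pos hroots w hc) (inr_notMem_badPlaces_ratCast_of_pos hroots w hc')
    have hdiff : badPlaces (c : realField R) (AdjoinRoot.root (realPolyQ R)) \ {Sum.inl v₀} =
        badPlaces (c' : realField R) (AdjoinRoot.root (realPolyQ R)) \ {Sum.inl v₀} := by
      ext x
      simp only [Set.mem_sdiff, Set.mem_singleton_iff]
      exact ⟨fun ⟨h1, h2⟩ ↦ ⟨(hoff x h2).1 h1, h2⟩, fun ⟨h1, h2⟩ ↦ ⟨(hoff x h2).2 h1, h2⟩⟩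
    -- the ramified place follows by parity
    have h₀ : Sum.inl v₀ ∈ badPlaces (c : realField R) (AdjoinRoot.root (realPolyQ R)) ↔
        Sum.inl v₀ ∈ badPlaces (c' : realField R) (AdjoinRoot.root (realPolyQ R)) := by
      have e1 := mem_badPlaces_iff_odd_ncard_diff_singleton (R := R) γ (Sum.inl v₀)
      have e2 := mem_badPlaces_iff_odd_ncard_diff_singleton (R := R) γ' (Sum.inl v₀)
      rw [hγ] at e1
      rw [hγ'] at e2
      rw [e1, e2, hdiff]
    ext x
    by_cases hx : x = Sum.inl v₀
    · rw [hx]; exact h₀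
    · exact hoff x hx

/-- **THE SPLIT ROW (cyclic form): `[c] = [(-1)^k]` (`k` even) `⟺ ord_ℓ(c)` is EVEN at every non-norm prime `ℓ`**,
`c ∈ ℚ_{>0}`, under the hypotheses of §133 and `T(p₀) = ∅`. [cite: Deligne1982HodgeCycles, §4 Cor. 4.2]
[cite: Omeara1963, §65D Thm. 65:23 and §71D Thm. 71:18] -/
theorem mk_ratCast_eq_splitDiscriminantClassCM_iff_of_ramified {p q : ℤ} (hR : R = X ^ 2 + C p * X + C q)
    (hroots : ∀ s : ℂ, Polynomial.eval₂ (Int.castRingHom ℂ) s R = 0 → s.im = 0 ∧ s.re < 0)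
    {θₒ s₀ : 𝓞 (realField R)} (hθ : (θₒ : realField R) = AdjoinRoot.root (realPolyQ R)) (hs : s₀ ^ 2 = q)
    {p₀ : ℕ} (hp₀ : p₀.Prime) (hp₀q : (p₀ : ℤ) ∣ 2 * q)
    (huq : ∀ ℓ : ℕ, ℓ.Prime → (ℓ : ℤ) ∣ 2 * q → ∀ v v' : HeightOneSpectrum (𝓞 (realField R)),
      (ℓ : 𝓞 (realField R)) ∈ v.asIdeal → (ℓ : 𝓞 (realField R)) ∈ v'.asIdeal → v = v')
    (hfix : ∀ v : HeightOneSpectrum (𝓞 (realField R)), (p₀ : 𝓞 (realField R)) ∉ v.asIdeal →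
      ∀ ℓ : ℕ, ℓ.Prime → Sum.inl v ∈ badPlaces (ℓ : realField R) (AdjoinRoot.root (realPolyQ R)) →
        (ℓ : 𝓞 (realField R)) ∈ v.asIdeal)
    (hT₀ : badPlaces (p₀ : realField R) (AdjoinRoot.root (realPolyQ R)) = ∅)
    {c : ℚ} (hc : 0 < c) (γ : (realField R)ˣ) (hγ : (γ : realField R) = (c : realField R)) {k : ℕ} (hk : Even k) :
    (QuotientGroup.mk γ : cmNormResidueGroup R) = splitDiscriminantClassCM R k ↔
      ∀ ℓ : ℕ, ℓ.Prime → (badPlaces (ℓ : realField R) (AdjoinRoot.root (realPolyQ R))).Nonempty →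
        Even (padicValRat ℓ c) := by
  rw [splitDiscriminantClassCM, hk.neg_one_pow,
    mk_ratCast_eq_mk_ratCast_iff_of_ramified hR hroots hθ hs hp₀ hp₀q huq hfix hT₀ hc one_pos γ 1 hγ
      (by rw [Units.val_one, Rat.cast_one])]
  refine forall_congr' fun ℓ ↦ forall_congr' fun hℓ ↦ forall_congr' fun _ ↦ ?_
  haveI : Fact ℓ.Prime := ⟨hℓ⟩
  rw [padicValRat.one, ← Int.not_even_iff_odd, ← Int.not_even_iff_odd]
  exact ⟨fun h ↦ not_not.1 fun hne ↦ (h.1 hne) ⟨0, rfl⟩, fun h ↦ ⟨fun hne ↦ absurd h hne, fun h0 ↦ absurd ⟨0, rfl⟩ h0⟩⟩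

end Summit.HodgeConjecture.HodgeConjecture.Ring2.WeilCoverageCM

end
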